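import Literature.NumberTheory.LFunctions.SoundararajanProp1
import Literature.NumberTheory.LFunctions.VTypicalOrdinates2008
import HarnessLib

/-!
# The engine of Soundararajan's method under RH: Balazard–de Roton 2008, Props. 1, 18, 20 together

Topic `Literature/NumberTheory/LFunctions`. Everything here is PROVED. The Soundararajan-contour files
(`SoundararajanContour.lean`, `SoundararajanContourDyadic.lean`, `TypicalOrdinate*.lean`), which reduce
M. Balazard–A. de Roton's bound `M(x) ≪ √x exp((log x)^{1/2}(log log x)^{5/2+δ})` (arXiv:0810.3587,
Théorème 1; the input (A) of `BalazardDeRoton2010_thm1_of_deep`) to Soundararajan's method, take three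
hypotheses: `TypicalPointwise.Prop1With δ D T₁` (Prop. 1), `TypicalLadder.Prop18With δ T₁₈`
(Prop. 18), `TypicalCounting.Prop20With δ C D₂₀ T₂₀` (Prop. 20). This file records that all three are
theorems under RH for every `0 < δ ≤ 1` (`SoundTest.prop1With_of_RH`, `prop18With_of_RH'`,
`prop20With_of_RH`), with `C = 1`, `D₂₀ = 12`.

## References

* [BalazardDeRoton2008] M. Balazard, A. de Roton, arXiv:0810.3587, Props. 1, 18, 20. [cite: BalazardDeRoton2008, Props. 1, 18, 20]
-/

noncomputable section

namespace Literature.NumberTheory.LFunctions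

/-- **The engine of Soundararajan's method, under RH** (Balazard–de Roton 2008, Props. 1, 18 and 20,
in the shapes consumed by the contour files): for every `0 < δ ≤ 1` there are `D ≥ 0`, `T₁`, `T₁₈`,
`T₂₀` with `Prop1With δ D T₁`, `Prop18With δ T₁₈` and `Prop20With δ 1 12 T₂₀`. [cite: BalazardDeRoton2008, Props. 1, 18, 20] -/
theorem exists_soundararajan_engine_of_RH (hRH : RiemannHypothesis) {δ : ℝ} (hδ0 : 0 < δ) (hδ1 : δ ≤ 1) :
    ∃ D T₁ T₁₈ T₂₀ : ℝ, 0 ≤ D ∧ TypicalPointwise.Prop1With δ D T₁ ∧ TypicalLadder.Prop18With δ T₁₈ ∧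
      TypicalCounting.Prop20With δ 1 12 T₂₀ := by
  obtain ⟨D, T₁, hD, h1⟩ := SoundTest.prop1With_of_RH hRH hδ0 hδ1
  obtain ⟨T₁₈, h18⟩ := prop18With_of_RH' hRH hδ0 hδ1
  obtain ⟨T₂₀, h20⟩ := prop20With_of_RH hRH hδ0 hδ1
  exact ⟨D, T₁, T₁₈, T₂₀, hD, h1, h18, h20⟩

end Literature.NumberTheory.LFunctions
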